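import Summits.SmoothPoincare4.SmoothPoincare4.Theorems.CylinderEntropyImmortalAreaToFloorCubeTelescoping
import HarnessLib

/-!
# Route `CylinderEntropy`, item `ImmortalAreaToFloor` (stmt-SmoothPoincare4-17197):
# cube telescoping — the SHARP form (deleted shadows) and the form INTEGRATED OVER LEVELS

Brick (TEL, levels) of the Allard-free blueprint for the residual `ThinSeq` of the item (evidence
`ANALYSIS-prover-17197-c1.md`, §6, CASE 1 of the per-ball lemma).  Two populations of columns `A, F ⊆ Q` whose
material profiles disagree on at least `d` levels give, level by level, pairs on opposite sides of the slice `U_c`;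
the landed cube telescoping (`CubeTelescoping.volume_inter_mul_volume_diff_le`) bounds those pairs by the frontier of
the slice.  This file PROVES:

* `volume_inter_mul_volume_diff_le_sum_shadow` — the SHARP form of the telescoping inequality, with the
  `j`-deleted shadows `volₙ(removeNth j '' (frontier U ∩ Q))` in place of `μH[n](frontier U ∩ Q)` (this is the
  quantity the coarea step of the blueprint controls through a `4`-volume of an image);
* `volume_prod_disagree_le` — at one level: the pairs `(a, f) ∈ Q × Q` on opposite sides of an open `U` have measure
  `≤ 2 · vol(Q) · ∑ⱼ (bⱼ - aⱼ) volₙ(removeNth j '' (frontier U ∩ Q))`;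
* **`mul_volume_mul_volume_le_lintegral_levels`** — INTEGRATED OVER LEVELS: for an open `U ⊆ (Fin (n+1) → ℝ) × ℝ`,
  a box `Q`, sets `A, F ⊆ Q` and `d ≥ 0` such that every pair `(a, f) ∈ A × F` lies on opposite sides of the slice
  `U_c = {x | (x, c) ∈ U}` for a set of levels `c` of measure `≥ d`:
  `d · vol(A) · vol(F) ≤ ∫⁻ c, 2 · vol(Q) · ∑ⱼ (bⱼ - aⱼ) volₙ(removeNth j '' (frontier U_c ∩ Q)) dc` (Tonelli).

Everything is proved; no definition, no named fact.
-/

noncomputable section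

-- the prescribed namespace `Summit.SmoothPoincare4.SmoothPoincare4.…` repeats `SmoothPoincare4`
set_option linter.dupNamespace false

open MeasureTheory Set Function Filter
open scoped ENNReal NNReal Topology BigOperators

namespace Summit.SmoothPoincare4.SmoothPoincare4.Theorems.CubeTelescoping

variable {n : ℕ}

/-- **Cube telescoping, sharp form**: for an open `U` and a box `Q = Icc a b` of `Fin (n+1) → ℝ`,
`vol(U ∩ Q) · vol(Q ∖ U) ≤ vol(Q) · ∑ⱼ (bⱼ - aⱼ) · volₙ(removeNth j '' (frontier U ∩ Q))` (the steps of the landed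
`volume_inter_mul_volume_diff_le` before the Lipschitz estimate of the deleted shadows). [cite: Federer1969, 4.5.3] -/
theorem volume_inter_mul_volume_diff_le_sum_shadow {U : Set (Fin (n + 1) → ℝ)} (hU : IsOpen U)
    (a b : Fin (n + 1) → ℝ) :
    volume (U ∩ Icc a b) * volume (Icc a b \ U) ≤
      volume (Icc a b) * ∑ j : Fin (n + 1), ENNReal.ofReal (b j - a j) *
        volume (Fin.removeNth j '' (frontier U ∩ Icc a b)) := by
  classical
  set S : Set (Fin (n + 1) → ℝ) := frontier U ∩ Icc a b with hS
  have hScpt : IsCompact S := (isCompact_Icc.inter_left isClosed_frontier)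
  have hAm : ∀ j : Fin (n + 1), MeasurableSet (Fin.removeNth j '' S) := fun j =>
    (hScpt.image (lipschitzWith_removeNth j).continuous).isClosed.measurableSet
  calc volume (U ∩ Icc a b) * volume (Icc a b \ U)
      = volume ((U ∩ Icc a b) ×ˢ (Icc a b \ U)) := by
        rw [Measure.volume_eq_prod, Measure.prod_prod]
    _ ≤ volume (⋃ j : Fin (n + 1),
          {z : (Fin (n + 1) → ℝ) × (Fin (n + 1) → ℝ) |
            Fin.removeNth j (fun i : Fin (n + 1) => if (i : ℕ) < (j : ℕ) then z.2 i else z.1 i) ∈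
              Fin.removeNth j '' S} ∩ Icc a b ×ˢ Icc a b) := measure_mono (prod_subset_iUnion hU a b)
    _ ≤ ∑ j : Fin (n + 1), volume ({z : (Fin (n + 1) → ℝ) × (Fin (n + 1) → ℝ) |
            Fin.removeNth j (fun i : Fin (n + 1) => if (i : ℕ) < (j : ℕ) then z.2 i else z.1 i) ∈
              Fin.removeNth j '' S} ∩ Icc a b ×ˢ Icc a b) := measure_iUnion_fintype_le _ _
    _ ≤ ∑ j : Fin (n + 1), ENNReal.ofReal (b j - a j) * volume (Fin.removeNth j '' S) * volume (Icc a b) :=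
        Finset.sum_le_sum fun j _ => volume_pathSet_le a b j (hAm j)
    _ = volume (Icc a b) * ∑ j : Fin (n + 1), ENNReal.ofReal (b j - a j) * volume (Fin.removeNth j '' S) := by
        rw [Finset.mul_sum]
        refine Finset.sum_congr rfl fun j _ => ?_
        ring

/-- **At one level: the pairs on opposite sides of an open set.** For an open `U` and a box `Q`, the set of pairs
`(x, y) ∈ Q × Q` with `x ∈ U ↔ y ∉ U` has measure
`≤ 2 · vol(Q) · ∑ⱼ (bⱼ - aⱼ) volₙ(removeNth j '' (frontier U ∩ Q))` (the two orientations of the sharp telescoping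
inequality). [folklore] -/
theorem volume_prod_disagree_le {U : Set (Fin (n + 1) → ℝ)} (hU : IsOpen U) (a b : Fin (n + 1) → ℝ) :
    volume {z : (Fin (n + 1) → ℝ) × (Fin (n + 1) → ℝ) | z ∈ Icc a b ×ˢ Icc a b ∧ (z.1 ∈ U ↔ z.2 ∉ U)} ≤
      2 * (volume (Icc a b) * ∑ j : Fin (n + 1), ENNReal.ofReal (b j - a j) *
        volume (Fin.removeNth j '' (frontier U ∩ Icc a b))) := by
  have hsub : {z : (Fin (n + 1) → ℝ) × (Fin (n + 1) → ℝ) | z ∈ Icc a b ×ˢ Icc a b ∧ (z.1 ∈ U ↔ z.2 ∉ U)} ⊆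
      (U ∩ Icc a b) ×ˢ (Icc a b \ U) ∪ (Icc a b \ U) ×ˢ (U ∩ Icc a b) := by
    rintro ⟨x, y⟩ ⟨⟨hx, hy⟩, hiff⟩
    by_cases hxU : x ∈ U
    · exact Or.inl ⟨⟨hxU, hx⟩, hy, hiff.1 hxU⟩
    · refine Or.inr ⟨⟨hx, hxU⟩, ?_, hy⟩
      by_contra hyU
      exact hxU (hiff.2 hyU)
  have h1 := volume_inter_mul_volume_diff_le_sum_shadow hU a b
  calc volume {z : (Fin (n + 1) → ℝ) × (Fin (n + 1) → ℝ) | z ∈ Icc a b ×ˢ Icc a b ∧ (z.1 ∈ U ↔ z.2 ∉ U)}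
      ≤ volume ((U ∩ Icc a b) ×ˢ (Icc a b \ U)) + volume ((Icc a b \ U) ×ˢ (U ∩ Icc a b)) :=
        (measure_mono hsub).trans (measure_union_le _ _)
    _ = volume (U ∩ Icc a b) * volume (Icc a b \ U) + volume (Icc a b \ U) * volume (U ∩ Icc a b) := by
        rw [Measure.volume_eq_prod, Measure.prod_prod, Measure.prod_prod]
    _ ≤ _ := by rw [mul_comm (volume (Icc a b \ U)), two_mul]; exact add_le_add h1 h1

/-- **Cube telescoping integrated over levels.** Let `U ⊆ (Fin (n+1) → ℝ) × ℝ` be open, `Q = Icc a b` a box,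
`A, F ⊆ Q` measurable sets and `d ≥ 0` such that for every `x ∈ A`, `y ∈ F` the set of levels `c` at which `x` and
`y` lie on opposite sides of the slice `U_c = {x | (x, c) ∈ U}` has measure `≥ d`.  Then
`d · vol(A) · vol(F) ≤ ∫⁻ c, 2 · vol(Q) · ∑ⱼ (bⱼ - aⱼ) · volₙ(removeNth j '' (frontier U_c ∩ Q)) dc`
(Tonelli over `(x, y, c)` and `volume_prod_disagree_le` at each level; every slice of an open set is open).
[folklore] -/
theorem mul_volume_mul_volume_le_lintegral_levels {U : Set ((Fin (n + 1) → ℝ) × ℝ)} (hU : IsOpen U)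
    (a b : Fin (n + 1) → ℝ) {A F : Set (Fin (n + 1) → ℝ)} (hAm : MeasurableSet A) (hFm : MeasurableSet F)
    (hA : A ⊆ Icc a b) (hF : F ⊆ Icc a b) {d : ℝ≥0∞}
    (hdis : ∀ x ∈ A, ∀ y ∈ F, d ≤ volume {c : ℝ | ((x, c) ∈ U ↔ (y, c) ∉ U)}) :
    d * volume A * volume F ≤
      ∫⁻ c : ℝ, 2 * (volume (Icc a b) * ∑ j : Fin (n + 1), ENNReal.ofReal (b j - a j) *
        volume (Fin.removeNth j '' (frontier {x : Fin (n + 1) → ℝ | (x, c) ∈ U} ∩ Icc a b))) := by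
  classical
  -- the disagreement set in `(x, y, c)` is measurable
  have hUm : MeasurableSet U := hU.measurableSet
  set D : Set (((Fin (n + 1) → ℝ) × (Fin (n + 1) → ℝ)) × ℝ) :=
    {w | w.1 ∈ A ×ˢ F ∧ ((w.1.1, w.2) ∈ U ↔ (w.1.2, w.2) ∉ U)} with hD
  have hm1 : Measurable fun w : ((Fin (n + 1) → ℝ) × (Fin (n + 1) → ℝ)) × ℝ => (w.1.1, w.2) :=
    (measurable_fst.comp measurable_fst).prodMk measurable_snd
  have hm2 : Measurable fun w : ((Fin (n + 1) → ℝ) × (Fin (n + 1) → ℝ)) × ℝ => (w.1.2, w.2) :=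
    (measurable_snd.comp measurable_fst).prodMk measurable_snd
  have hDm : MeasurableSet D := by
    have h1 : MeasurableSet {w : ((Fin (n + 1) → ℝ) × (Fin (n + 1) → ℝ)) × ℝ | (w.1.1, w.2) ∈ U} := hm1 hUm
    have h2 : MeasurableSet {w : ((Fin (n + 1) → ℝ) × (Fin (n + 1) → ℝ)) × ℝ | (w.1.2, w.2) ∈ U} := hm2 hUm
    have hiff : {w : ((Fin (n + 1) → ℝ) × (Fin (n + 1) → ℝ)) × ℝ | ((w.1.1, w.2) ∈ U ↔ (w.1.2, w.2) ∉ U)} =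
        ({w | (w.1.1, w.2) ∈ U} \ {w | (w.1.2, w.2) ∈ U}) ∪ ({w | (w.1.2, w.2) ∈ U} \ {w | (w.1.1, w.2) ∈ U}) := by
      ext w
      simp only [mem_setOf_eq, mem_union, Set.mem_sdiff]
      tauto
    have : D = (A ×ˢ F) ×ˢ (univ : Set ℝ) ∩
        {w | ((w.1.1, w.2) ∈ U ↔ (w.1.2, w.2) ∉ U)} := by
      ext w; simp [hD]
    rw [this, hiff]
    exact ((hAm.prod hFm).prod MeasurableSet.univ).inter ((h1.diff h2).union (h2.diff h1))
  -- Tonelli, integrating first over `c`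
  have hlow : d * volume A * volume F ≤ volume D := by
    have hsec : ∀ z : (Fin (n + 1) → ℝ) × (Fin (n + 1) → ℝ), z ∈ A ×ˢ F →
        d ≤ volume (Prod.mk z ⁻¹' D) := by
      rintro ⟨x, y⟩ ⟨hx, hy⟩
      have : Prod.mk (x, y) ⁻¹' D = {c : ℝ | ((x, c) ∈ U ↔ (y, c) ∉ U)} := by
        ext c; simp [hD, hx, hy]
      rw [this]; exact hdis x hx y hy
    calc d * volume A * volume F = d * volume (A ×ˢ F) := by
          rw [Measure.volume_eq_prod, Measure.prod_prod, mul_assoc]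
      _ = ∫⁻ z in A ×ˢ F, d ∂volume := by rw [setLIntegral_const, mul_comm]
      _ ≤ ∫⁻ z in A ×ˢ F, volume (Prod.mk z ⁻¹' D) ∂volume := setLIntegral_mono' (hAm.prod hFm) fun z hz => hsec z hz
      _ ≤ ∫⁻ z, volume (Prod.mk z ⁻¹' D) ∂volume := setLIntegral_le_lintegral _ _
      _ = volume D := by rw [Measure.volume_eq_prod ((Fin (n + 1) → ℝ) × (Fin (n + 1) → ℝ)) ℝ, Measure.prod_apply hDm]
  -- Tonelli, integrating first over the pairs
  have hup : volume D = ∫⁻ c : ℝ, volume {z : (Fin (n + 1) → ℝ) × (Fin (n + 1) → ℝ) | (z, c) ∈ D} := by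
    rw [Measure.volume_eq_prod ((Fin (n + 1) → ℝ) × (Fin (n + 1) → ℝ)) ℝ, Measure.prod_apply_symm hDm]
    rfl
  refine hlow.trans ?_
  rw [hup]
  refine lintegral_mono fun c => ?_
  -- at level `c`
  have hUc : IsOpen {x : Fin (n + 1) → ℝ | (x, c) ∈ U} := hU.preimage (Continuous.prodMk_left c)
  have hsub : {z : (Fin (n + 1) → ℝ) × (Fin (n + 1) → ℝ) | (z, c) ∈ D} ⊆
      {z | z ∈ Icc a b ×ˢ Icc a b ∧ (z.1 ∈ {x : Fin (n + 1) → ℝ | (x, c) ∈ U} ↔ z.2 ∉ {x : Fin (n + 1) → ℝ | (x, c) ∈ U})} := by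
    rintro ⟨x, y⟩ ⟨⟨hx, hy⟩, hiff⟩
    exact ⟨⟨hA hx, hF hy⟩, hiff⟩
  exact (measure_mono hsub).trans (volume_prod_disagree_le hUc a b)

end Summit.SmoothPoincare4.SmoothPoincare4.Theorems.CubeTelescoping

end
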